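import Summits.ValiantsHypothesis.ValiantsHypothesis.Theses.DivisionGap
import Summits.ValiantsHypothesis.ValiantsHypothesis.Theorems.DivisionGapDefs
import Summits.ValiantsHypothesis.ValiantsHypothesis.Theorems.DivisionGapPerDivisionHardStubTorusSupport
import Summits.ValiantsHypothesis.ValiantsHypothesis.Theorems.DivisionGapPerDivisionHardStubFaceDescent
import Summits.ValiantsHypothesis.ValiantsHypothesis.Theorems.DivisionGapPerDivisionHardStubJssContraction
import Summits.ValiantsHypothesis.ValiantsHypothesis.Theorems.DivisionGapPerDivisionHardStubBlockArsenal
import Summits.ValiantsHypothesis.ValiantsHypothesis.Theorems.DivisionGapPerDivisionHardStubTransposePair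
import Summits.ValiantsHypothesis.ValiantsHypothesis.Theorems.DivisionGapPerDivisionHardStubHeavyLines
import Summits.ValiantsHypothesis.ValiantsHypothesis.Theorems.DivisionGapPerDivisionHardStubCellContentRigid

/-!
# Crux `DivisionGap.PerDivisionHard` (stmt-ValiantsHypothesis-5065) — the CELL-CONTENT RUNG, unconditionally:
monotone rank across an ARBITRARY balanced partition of the variables

`PerDivisionHard` asks, for every `c` and all large `n`, that every nonzero cofactor `h ∈ ℝ≥0[x_ij]` satisfies
`2^{(log₂ n + c)^c} < L(per_n · h) + L(h)` (monotone fan-in-two `complexity` over `ℝ≥0`).  For a set `Y` of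
cells of the `n × n` matrix and a monomial `x^m` put
`Φ_Y(m) := ((Σ_{c : (r,c) ∈ Y} m(r,c))_r, (Σ_{r : (r,c) ∈ Y} m(r,c))_c)` — the row and column margins of the
part of `m` inside `Y` — and `V_Y(h) := {Φ_Y(m) : m ∈ supp h}`.  `|V_Y(h)|` is the support-level, nonnegative version
of the rank of the coefficient matrix of `h` with respect to the partition of the VARIABLES into `Y` and `Yᶜ`
(Nisan's measure; Raz's partial-derivative matrix for an arbitrary partition): a torus-homogeneous
`h = Σ_{t<W} f_t(x_Y) · g_t(x_{Yᶜ})` has `|V_Y(h)| ≤ W`.  This file proves the crux inequality for every cofactor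
of quasi-polynomial rank across SOME balanced partition of the variables:

* `perDivisionHard_cellContent` — **∀ c, ∃ n₀, ∀ n ≥ n₀, ∀ h ≠ 0, ∀ Y with `n² ≤ 4|Y| ≤ 3n²`:
  `|V_Y(h)| ≤ 2^{(log₂ n + c)^c}` ⇒ `2^{(log₂ n + c)^c} < L(per_n · h) + L(h)`.**

So an undecided cofactor of the crux has full monotone rank across EVERY balanced partition of the matrix
variables — Raz's "full-rank polynomial" hypothesis, verbatim the signature of the permanent and the determinant.
The row-cut case `Y = A × [n]` is `Theorems/DivisionGapPerDivisionHardColContent.lean`.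

Mechanism (composition `perDivisionHard_cellContentCol` + mode selection; every stub a landed theorem of skeleton v14
of line `pair-descent-jss-endpoint`, `Cruxes/PerDivisionHard/Lines/pair_descent_jss_endpoint.lean`).  A column is
LIVE if it has more than `n/64` cells in `Y` and more than `n/64` outside; a balanced `Y` has `≥ n/8` live columns
or `≥ n/8` live rows (`stub_heavyLines`, double counting).  Column mode (`stub_cellContentRigid`): the torus normal
form keeps a sub-support (`stub_torusSupport`); choose the core COLUMN set of the subdivided block `G(b,k) ⊕ M₀`
inside the live columns by the union bound over pairs of `Y`-column contents, then the ROWS greedily so that `Y`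
splits the two path cells of every internal column (`stub_greedyRows`); a nonzero circulation of the placed graph is
constant in absolute value along a path, so its `Y`-column-sums are nonzero on `≥ k-1` core columns
(`stub_splitFlow`) — impossible for two monomials of the cofactor by the choice of the columns; so the generic cut
has a one-element top fibre, and face descent (`stub_faceDescent`) → JSS contraction (`stub_jssContraction`) → the
placed face is harder (`stub_blockArsenal`).  Row mode: transpose (`stub_transposePair`: `per_n` is symmetric,
renames are free).
-/

noncomputable section

-- `Summit.ValiantsHypothesis.ValiantsHypothesis.…` is the tree's mandated single-conjunct layout
-- (Sub = Summit), so the duplicated namespace component is intended.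
set_option linter.dupNamespace false

namespace Summit.ValiantsHypothesis.ValiantsHypothesis.Theorems.DivisionGapPerDivisionHard

open MvPolynomial Literature.Computability.AlgebraicComplexity
open scoped NNReal

/-- Torus homogeneity is invariant under transposition of the matrix variables. [folklore] -/
theorem isTorusHomogeneous_rename_swap {n : ℕ} {h : MvPolynomial (Fin n × Fin n) ℝ≥0}
    (htor : IsTorusHomogeneous h) :
    IsTorusHomogeneous (rename (Prod.swap : Fin n × Fin n → Fin n × Fin n) h) := by
  classical
  obtain ⟨r₀, c₀, hrc⟩ := htor
  refine ⟨c₀, r₀, fun m hm => ?_⟩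
  rw [support_rename_of_injective Prod.swap_injective, Finset.mem_image] at hm
  obtain ⟨m₀, hm₀, rfl⟩ := hm
  obtain ⟨h1, h2⟩ := hrc m₀ hm₀
  constructor
  · rw [rowDegrees, ← Finsupp.mapDomain_comp]
    change Finsupp.mapDomain Prod.snd m₀ = c₀
    exact h2
  · rw [← Finsupp.mapDomain_comp]
    change Finsupp.mapDomain Prod.fst m₀ = r₀
    exact h1

/-- **Column mode, pair interface.**  For every `c` there is `n₀` such that for all `n ≥ n₀`: if `h'` is nonzero,
torus-homogeneous, no more expensive than `h` in either complexity, and its monomials have at most `2^{(log₂ n+c)^c}`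
distinct `Y`-column contents for a cell set `Y` with at least `n/8` live columns, then `2^{(log₂ n+c)^c} < L(per_n·h) + L(h)`.
(`stub_cellContentRigid` → face descent → JSS contraction → block arsenal.) [folklore] -/
theorem two_pow_lt_pair_of_cellContentCol (c : ℕ) :
    ∃ n₀ : ℕ, ∀ n ≥ n₀, ∀ h h' : MvPolynomial (Fin n × Fin n) ℝ≥0, h' ≠ 0 → IsTorusHomogeneous h' →
      complexity (perPoly (Fin n) ℝ≥0 * h') ≤ complexity (perPoly (Fin n) ℝ≥0 * h) →
      ∀ Y : Finset (Fin n × Fin n),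
      n ≤ 8 * (Finset.univ.filter fun cc : Fin n =>
          n / 64 < (Finset.univ.filter fun r : Fin n => (r, cc) ∈ Y).card ∧
          n / 64 < (Finset.univ.filter fun r : Fin n => (r, cc) ∉ Y).card).card →
      (h'.support.image fun (mm : (Fin n × Fin n) →₀ ℕ) (cc : Fin n) =>
          ∑ r ∈ Finset.univ.filter (fun r : Fin n => (r, cc) ∈ Y), mm (r, cc)).card ≤ 2 ^ ((Nat.log 2 n + c) ^ c) →
      2 ^ ((Nat.log 2 n + c) ^ c) < complexity (perPoly (Fin n) ℝ≥0 * h) + complexity h := by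
  obtain ⟨κ, hcon⟩ := stub_jssContraction
  obtain ⟨d, n₁, hhard⟩ := stub_blockArsenal c κ
  obtain ⟨n₀, hS⟩ := stub_cellContentRigid c d
  refine ⟨n₀ + n₁, ?_⟩
  intro n hn h h' hh' htor hle1 Y hlive hcard
  by_contra hlt
  have hle : complexity (perPoly (Fin n) ℝ≥0 * h) + complexity h ≤
      2 ^ ((Nat.log 2 n + c) ^ c) := not_lt.mp hlt
  obtain ⟨b, k, m, eR, eC, w, u, hb, hcut, hsingle⟩ := hS n (by omega) h' hh' htor Y hlive hcard
  have hdesc := stub_faceDescent n (placedBlock eR eC) w h' u hcut hh' hsingle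
  have h1 : complexity (monomial u (1 : ℝ≥0) * facePer (placedBlock eR eC)) ≤
      2 ^ ((Nat.log 2 n + c) ^ c) + 1 :=
    calc complexity (monomial u (1 : ℝ≥0) * facePer (placedBlock eR eC))
        ≤ complexity (perPoly (Fin n) ℝ≥0 * h') + 1 := hdesc
      _ ≤ complexity (perPoly (Fin n) ℝ≥0 * h) + 1 := Nat.add_le_add_right hle1 1
      _ ≤ 2 ^ ((Nat.log 2 n + c) ^ c) + 1 :=
          Nat.add_le_add_right (le_trans (Nat.le_add_right _ _) hle) 1
  have h2 : complexity (facePer (placedBlock eR eC)) ≤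
      ((n + 2) * (2 ^ ((Nat.log 2 n + c) ^ c) + 3)) ^ κ :=
    calc complexity (facePer (placedBlock eR eC))
        ≤ ((n + 2) * (complexity (monomial u (1 : ℝ≥0) * facePer (placedBlock eR eC)) + 2)) ^ κ :=
          hcon n (facePer (placedBlock eR eC)) u
      _ ≤ ((n + 2) * (2 ^ ((Nat.log 2 n + c) ^ c) + 3)) ^ κ :=
          Nat.pow_le_pow_left (Nat.mul_le_mul_left _ (by omega)) κ
  have h3 := hhard n (by omega) b k m eR eC hb
  exact absurd (lt_of_lt_of_le h3 h2) (lt_irrefl _)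

/-- **Both modes, pair interface.**  For every `c` there is `n₀` such that for all `n ≥ n₀`: if `h'` is nonzero,
torus-homogeneous, no more expensive than `h` (`L(per·h') ≤ L(per·h)`), and `|Φ_Y(supp h')| ≤ 2^{(log₂ n+c)^c}` for a
cell set `Y` with `n² ≤ 4|Y| ≤ 3n²`, then `2^{(log₂ n+c)^c} < L(per_n·h) + L(h)`.  Mode selection by `stub_heavyLines`;
column mode directly, row mode through the transpose of `h'` (`stub_transposePair`,
`isTorusHomogeneous_rename_swap`). [folklore] -/
theorem two_pow_lt_pair_of_cellContent (c : ℕ) :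
    ∃ n₀ : ℕ, ∀ n ≥ n₀, ∀ h h' : MvPolynomial (Fin n × Fin n) ℝ≥0, h' ≠ 0 → IsTorusHomogeneous h' →
      complexity (perPoly (Fin n) ℝ≥0 * h') ≤ complexity (perPoly (Fin n) ℝ≥0 * h) →
      ∀ Y : Finset (Fin n × Fin n), n * n ≤ 4 * Y.card → 4 * Y.card ≤ 3 * (n * n) →
      (h'.support.image fun (mm : (Fin n × Fin n) →₀ ℕ) =>
          ((fun r : Fin n => ∑ cc ∈ Finset.univ.filter (fun cc : Fin n => (r, cc) ∈ Y), mm (r, cc)),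
           (fun cc : Fin n => ∑ r ∈ Finset.univ.filter (fun r : Fin n => (r, cc) ∈ Y), mm (r, cc)))).card ≤
        2 ^ ((Nat.log 2 n + c) ^ c) →
      2 ^ ((Nat.log 2 n + c) ^ c) < complexity (perPoly (Fin n) ℝ≥0 * h) + complexity h := by
  obtain ⟨n₀, hcol⟩ := two_pow_lt_pair_of_cellContentCol c
  refine ⟨n₀ + 1, fun n hn h h' hh' htor hle1 Y hY₁ hY₂ hcard => ?_⟩
  classical
  have hn1 : 0 < n := by omega
  rcases stub_heavyLines n (n / 64) Y hY₁ hY₂ (Nat.mul_div_le n 64) hn1 with hC | hR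
  · -- column mode
    refine hcol n (by omega) h h' hh' htor hle1 Y hC (le_trans ?_ hcard)
    rw [show (fun (mm : (Fin n × Fin n) →₀ ℕ) (cc : Fin n) =>
          ∑ r ∈ Finset.univ.filter (fun r : Fin n => (r, cc) ∈ Y), mm (r, cc)) =
        Prod.snd ∘ (fun (mm : (Fin n × Fin n) →₀ ℕ) =>
          ((fun r : Fin n => ∑ cc ∈ Finset.univ.filter (fun cc : Fin n => (r, cc) ∈ Y), mm (r, cc)),
           (fun cc : Fin n => ∑ r ∈ Finset.univ.filter (fun r : Fin n => (r, cc) ∈ Y), mm (r, cc)))) from rfl,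
      ← Finset.image_image]
    exact Finset.card_image_le
  · -- row mode: transpose `h'`
    set sw : Fin n × Fin n → Fin n × Fin n := Prod.swap with hsw
    have hswinj : Function.Injective sw := Prod.swap_injective
    obtain ⟨hle1', -, hsupp⟩ := stub_transposePair n h'
    have hh'' : rename sw h' ≠ 0 := fun h0 => hh' (rename_injective sw hswinj (by rw [h0, map_zero]))
    have htor' : IsTorusHomogeneous (rename sw h') := isTorusHomogeneous_rename_swap htor
    set Y' : Finset (Fin n × Fin n) := Y.image sw with hY'
    have hmemY' : ∀ r cc : Fin n, (r, cc) ∈ Y' ↔ (cc, r) ∈ Y := by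
      intro r cc
      rw [hY', Finset.mem_image]
      constructor
      · rintro ⟨⟨a, b⟩, hab, he⟩
        simp only [hsw, Prod.swap_prod_mk, Prod.mk.injEq] at he
        obtain ⟨rfl, rfl⟩ := he
        exact hab
      · intro hmem
        exact ⟨(cc, r), hmem, rfl⟩
    have hlive' : n ≤ 8 * (Finset.univ.filter fun cc : Fin n =>
        n / 64 < (Finset.univ.filter fun r : Fin n => (r, cc) ∈ Y').card ∧
        n / 64 < (Finset.univ.filter fun r : Fin n => (r, cc) ∉ Y').card).card := by
      refine le_trans hR (le_of_eq ?_)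
      congr 2
      ext x
      simp only [Finset.mem_filter, Finset.mem_univ, true_and, hmemY']
    have hcard' : ((rename sw h').support.image fun (mm : (Fin n × Fin n) →₀ ℕ) (cc : Fin n) =>
        ∑ r ∈ Finset.univ.filter (fun r : Fin n => (r, cc) ∈ Y'), mm (r, cc)).card ≤ 2 ^ ((Nat.log 2 n + c) ^ c) := by
      rw [hsupp, Finset.image_image]
      refine le_trans ?_ hcard
      rw [show ((fun (mm : (Fin n × Fin n) →₀ ℕ) (cc : Fin n) =>
            ∑ r ∈ Finset.univ.filter (fun r : Fin n => (r, cc) ∈ Y'), mm (r, cc)) ∘ Finsupp.mapDomain sw) =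
          Prod.fst ∘ (fun (mm : (Fin n × Fin n) →₀ ℕ) =>
            ((fun r : Fin n => ∑ cc ∈ Finset.univ.filter (fun cc : Fin n => (r, cc) ∈ Y), mm (r, cc)),
             (fun cc : Fin n => ∑ r ∈ Finset.univ.filter (fun r : Fin n => (r, cc) ∈ Y), mm (r, cc)))) from ?_,
        ← Finset.image_image]
      · exact Finset.card_image_le
      · funext mm cc
        simp only [Function.comp_apply]
        refine Finset.sum_congr (by ext r; simp only [Finset.mem_filter, Finset.mem_univ, true_and, hmemY'])
          fun r _ => ?_
        change Finsupp.mapDomain sw mm (r, cc) = mm (cc, r)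
        rw [show ((r, cc) : Fin n × Fin n) = sw (cc, r) from rfl, Finsupp.mapDomain_apply hswinj]
    exact hcol n (by omega) h (rename sw h') hh'' htor' (hle1'.trans hle1) Y' hlive' hcard'

/-- **The cell-content rung of `PerDivisionHard`.**  For every `c` there is `n₀` such that for all `n ≥ n₀`, every
nonzero `h ∈ ℝ≥0[x_ij]` and every set `Y` of cells with `n² ≤ 4|Y| ≤ 3n²`: if the monomials of `h` have at most
`2^{(log₂ n + c)^c}` distinct `Y`-contents `Φ_Y(m) = ((Σ_{c:(r,c)∈Y} m(r,c))_r, (Σ_{r:(r,c)∈Y} m(r,c))_c)`, then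
`2^{(log₂ n + c)^c} < L(per_n · h) + L(h)` — bounded monotone (Nisan–Raz) rank across SOME balanced partition of the
variables forces the crux inequality.  No degree, sparsity, torus or circuit hypothesis on `h` (the torus normal form
keeps a sub-support, `stub_torusSupport`). [folklore] -/
theorem perDivisionHard_cellContent :
    ∀ c : ℕ, ∃ n₀ : ℕ, ∀ n ≥ n₀, ∀ h : MvPolynomial (Fin n × Fin n) ℝ≥0, h ≠ 0 → ∀ Y : Finset (Fin n × Fin n),
      n * n ≤ 4 * Y.card → 4 * Y.card ≤ 3 * (n * n) →
      (h.support.image fun (mm : (Fin n × Fin n) →₀ ℕ) =>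
          ((fun r : Fin n => ∑ cc ∈ Finset.univ.filter (fun cc : Fin n => (r, cc) ∈ Y), mm (r, cc)),
           (fun cc : Fin n => ∑ r ∈ Finset.univ.filter (fun r : Fin n => (r, cc) ∈ Y), mm (r, cc)))).card ≤
        2 ^ ((Nat.log 2 n + c) ^ c) →
      2 ^ ((Nat.log 2 n + c) ^ c) < complexity (perPoly (Fin n) ℝ≥0 * h) + complexity h := by
  intro c
  obtain ⟨n₀, hmain⟩ := two_pow_lt_pair_of_cellContent c
  refine ⟨n₀, fun n hn h hh Y hY₁ hY₂ hcard => ?_⟩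
  obtain ⟨h', hh', htor, hsupp, hle1, -⟩ := stub_torusSupport n h hh
  exact hmain n hn h h' hh' htor hle1 Y hY₁ hY₂
    (le_trans (Finset.card_le_card (Finset.image_subset_image hsupp)) hcard)

end Summit.ValiantsHypothesis.ValiantsHypothesis.Theorems.DivisionGapPerDivisionHard

end
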